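import Literature.NumberTheory.Automorphic.ArchLocalDiagonalFrameU21     -- ★ p843380∕p843389 (this seat): the `U21` bridge (pattern (+,+,−)); same tools, now frame-to-frame
import HarnessLib

/-!
# Two diagonal frames WITH THE SAME SIGN PATTERN are isomorphic by a real positive diagonal matrix commuting with the torus: `U(σ_{w₀} diag α₀)(ℂ) ≃ₜ* U(σ_w diag α)(ℂ)`,
# `t(z) ↦ t(z)`, Haar ↦ Haar, `Θ ↦ Θ ∘ Ad T` (Platonov–Rapinchuk 1994 §2.3; Rogawski 1990 §8.4 p. 126) — the frame half of ROAD A's brick (G) `archCentralLimitFormulaRankTwo_of_signs`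

Topic `NumberTheory/Automorphic`; namespace `Literature.NumberTheory.Automorphic.UnitaryGroup`.  THEOREMS ONLY (no `def` — the equivalence is ★ `unitaryGroupOfFormCongrOfEq`; no instance,
no notation, no axiom, no named fact, no `sorry`).  Cell `pub/hodgecm-mathlib`, ENGINE T1 (crux H413 = `stmt-HodgeConjecture-24833`); ROAD A toward N1 = the registered stub `stub_L21`
(closer ED. 25, typed `∀ (L : Type) [Field L] …`) — LEAD F0P3a-plan (g10) WORD T9-15 (3): «(G) = ONE brick `archCentralLimitFormulaRankTwo_of_signs` … owned by A-p18»: the in-house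
(J-nc) proof is CM-only, so the letter is proved ONCE at a CM instance per sign pattern and TRANSPORTED to every field `L` with a complex place; author A-p18 (g25), 2026-09-01.

THE FRAME.  For `a = re σ_w(α) ∈ (ℝ^×)³` and `a₀ = re σ_{w₀}(α₀)` with `a_i a₀_i > 0` (same signs), `T = diag(√(a₀_i ∕ a_i))` is real positive diagonal, `Tᴴ·diag(a)·T = diag(a₀)`, and `T`
commutes with every `diag z`.  Hence (★ `unitaryGroupOfFormCongrOfEq`) `e : U(σ_{w₀} diag α₀)(ℂ) ≃ₜ* U(σ_w diag α)(ℂ)`, `e u = T u T⁻¹`, `e (t z) = t z`; along `e`, torus orbital integrals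
of `Θ` on the target equal torus orbital integrals of `Θ ∘ Ad T : M ↦ Θ(T M T⁻¹)` on the source against the transported measure, AT THE SAME torus point `z` (§3); Haar and right
invariance are transported (§4); `Θ ∘ Ad T` keeps smoothness and compact support (§5); and `Θ ∘ Ad T` agrees with `Θ` on the torus (§5).
HONEST LABEL: frame bookkeeping; proves nothing about HC_CM, which is proved only modulo the printed citations until rung 0 closes.

## References
* [PlatonovRapinchuk1994] V. Platonov, A. Rapinchuk, *Algebraic Groups and Number Theory* (1994), §2.3.
* [Rogawski1990] J. D. Rogawski, *Automorphic Representations of Unitary Groups in Three Variables*, Ann. of Math. Stud. 123 (1990), §8.4 pp. 126–127.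
-/

set_option autoImplicit false

noncomputable section

open MeasureTheory Measure NumberField NumberField.InfinitePlace Topology Matrix

namespace Literature.NumberTheory.Automorphic.UnitaryGroup

section SignFrame

variable (L : Type) [Field L] (α : Fin 3 → L) (w : {w : InfinitePlace L // IsComplex w})
variable (L₀ : Type) [Field L₀] (α₀ : Fin 3 → L₀) (w₀ : {w : InfinitePlace L₀ // IsComplex w})

/-- **THE SIGN-PATTERN FRAME.**  If `σ_wα_i` and `σ_{w₀}α₀_i` are real with the same signs, `T = diag(√(re σ_{w₀}α₀_i ∕ re σ_wα_i))` satisfies `Tᴴ·σ_w(diag α)·T = σ_{w₀}(diag α₀)` and commutes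
with the torus. [cite: PlatonovRapinchuk1994, §2.3] [cite: Rogawski1990, §8.4 p. 126] -/
theorem exists_signFrame_formCongr_eq (hreal : ∀ i, (w.1.embedding (α i)).im = 0) (hreal₀ : ∀ i, (w₀.1.embedding (α₀ i)).im = 0)
    (hsame : ∀ i, 0 < (w.1.embedding (α i)).re * (w₀.1.embedding (α₀ i)).re) :
    ∃ T : GL (Fin 3) ℂ, ((T : Matrix (Fin 3) (Fin 3) ℂ) = Matrix.diagonal fun i => ((Real.sqrt ((w₀.1.embedding (α₀ i)).re / (w.1.embedding (α i)).re) : ℝ) : ℂ)) ∧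
      formCongr (starRingEnd ℂ) T ((Matrix.diagonal α).map w.1.embedding) = (Matrix.diagonal α₀).map w₀.1.embedding ∧
      ∀ z : Fin 3 → Circle, T⁻¹ * circleDiagonal 3 z * T = circleDiagonal 3 z := by
  have hq : ∀ i, 0 < (w₀.1.embedding (α₀ i)).re / (w.1.embedding (α i)).re := by
    intro i
    rcases pos_and_pos_or_neg_and_neg_of_mul_pos (hsame i) with ⟨ha, hb⟩ | ⟨ha, hb⟩
    · exact div_pos hb ha
    · exact div_pos_of_neg_of_neg hb ha
  have hr : ∀ i, Real.sqrt ((w₀.1.embedding (α₀ i)).re / (w.1.embedding (α i)).re) ≠ 0 := fun i => (Real.sqrt_pos.2 (hq i)).ne'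
  set D : Matrix (Fin 3) (Fin 3) ℂ := Matrix.diagonal fun i => ((Real.sqrt ((w₀.1.embedding (α₀ i)).re / (w.1.embedding (α i)).re) : ℝ) : ℂ) with hD
  have hdet : D.det ≠ 0 := by
    rw [hD, Matrix.det_diagonal]
    exact Finset.prod_ne_zero_iff.2 fun i _ => Complex.ofReal_ne_zero.2 (hr i)
  refine ⟨Matrix.GeneralLinearGroup.mkOfDetNeZero D hdet, rfl, ?_, ?_⟩
  · have hz : ∀ i, w.1.embedding (α i) = (((w.1.embedding (α i)).re : ℝ) : ℂ) := fun i =>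
      (Complex.conj_eq_iff_re.1 (Complex.conj_eq_iff_im.2 (hreal i))).symm
    have hz₀ : ∀ i, w₀.1.embedding (α₀ i) = (((w₀.1.embedding (α₀ i)).re : ℝ) : ℂ) := fun i =>
      (Complex.conj_eq_iff_re.1 (Complex.conj_eq_iff_im.2 (hreal₀ i))).symm
    have hH : (Matrix.diagonal α).map w.1.embedding = Matrix.diagonal fun i => (((w.1.embedding (α i)).re : ℝ) : ℂ) := by
      rw [Matrix.diagonal_map (map_zero _)]; congr 1; funext i; exact hz i
    have hH₀ : (Matrix.diagonal α₀).map w₀.1.embedding = Matrix.diagonal fun i => (((w₀.1.embedding (α₀ i)).re : ℝ) : ℂ) := by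
      rw [Matrix.diagonal_map (map_zero _)]; congr 1; funext i; exact hz₀ i
    show ((D.map (starRingEnd ℂ))ᵀ * ((Matrix.diagonal α).map w.1.embedding) * D) = (Matrix.diagonal α₀).map w₀.1.embedding
    have hDmap : D.map (starRingEnd ℂ) = D := by
      rw [hD, Matrix.diagonal_map (map_zero _)]; congr 1; funext i; exact Complex.conj_ofReal _
    rw [hDmap, hD, Matrix.diagonal_transpose, hH, hH₀, Matrix.diagonal_mul_diagonal, Matrix.diagonal_mul_diagonal]
    congr 1
    funext i
    have hsq : Real.sqrt ((w₀.1.embedding (α₀ i)).re / (w.1.embedding (α i)).re) ^ 2 = (w₀.1.embedding (α₀ i)).re / (w.1.embedding (α i)).re :=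
      Real.sq_sqrt (hq i).le
    have ha : (w.1.embedding (α i)).re ≠ 0 := fun h => by have := hsame i; rw [h, zero_mul] at this; exact lt_irrefl _ this
    have e1 : Real.sqrt ((w₀.1.embedding (α₀ i)).re / (w.1.embedding (α i)).re) * (w.1.embedding (α i)).re *
        Real.sqrt ((w₀.1.embedding (α₀ i)).re / (w.1.embedding (α i)).re) = (w₀.1.embedding (α₀ i)).re := by
      rw [show Real.sqrt ((w₀.1.embedding (α₀ i)).re / (w.1.embedding (α i)).re) * (w.1.embedding (α i)).re *
          Real.sqrt ((w₀.1.embedding (α₀ i)).re / (w.1.embedding (α i)).re) =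
          Real.sqrt ((w₀.1.embedding (α₀ i)).re / (w.1.embedding (α i)).re) ^ 2 * (w.1.embedding (α i)).re by ring, hsq]
      field_simp
    have e2 := congrArg (fun x : ℝ => (x : ℂ)) e1
    push_cast at e2 ⊢
    exact e2
  · intro z
    rw [mul_assoc, inv_mul_eq_iff_eq_mul]
    apply Units.ext
    change (circleDiagonal 3 z : Matrix (Fin 3) (Fin 3) ℂ) * D = D * (circleDiagonal 3 z : Matrix (Fin 3) (Fin 3) ℂ)
    rw [coe_circleDiagonal, hD, Matrix.diagonal_mul_diagonal, Matrix.diagonal_mul_diagonal]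
    congr 1; funext i; ring

/-- **`U(σ_{w₀} diag α₀)(ℂ) ≃ₜ* U(σ_w diag α)(ℂ)` CARRYING THE TORUS TO THE TORUS** (same sign pattern): `∃ T e, e u = T u T⁻¹ ∧ e (t z) = t z` (★ `unitaryGroupOfFormCongrOfEq`).
[cite: PlatonovRapinchuk1994, §2.3] [cite: Rogawski1990, §8.4 p. 126] -/
theorem exists_continuousMulEquiv_archLocal_of_signs (hreal : ∀ i, (w.1.embedding (α i)).im = 0) (hreal₀ : ∀ i, (w₀.1.embedding (α₀ i)).im = 0)
    (hsame : ∀ i, 0 < (w.1.embedding (α i)).re * (w₀.1.embedding (α₀ i)).re) :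
    ∃ (T : GL (Fin 3) ℂ) (e : archLocal L₀ 3 (Matrix.diagonal α₀) w₀ ≃ₜ* archLocal L 3 (Matrix.diagonal α) w),
      (∀ u : archLocal L₀ 3 (Matrix.diagonal α₀) w₀, ((e u : archLocal L 3 (Matrix.diagonal α) w) : GL (Fin 3) ℂ) = T * (u : GL (Fin 3) ℂ) * T⁻¹) ∧
      (∀ z : Fin 3 → Circle, e ⟨circleDiagonal 3 z, circleDiagonal_mem_archLocal_diagonal L₀ 3 α₀ w₀ z⟩ =
        ⟨circleDiagonal 3 z, circleDiagonal_mem_archLocal_diagonal L 3 α w z⟩) ∧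
      ∀ z : Fin 3 → Circle, (T : Matrix (Fin 3) (Fin 3) ℂ) * Matrix.diagonal (fun i => (z i : ℂ)) * ((T⁻¹ : GL (Fin 3) ℂ) : Matrix (Fin 3) (Fin 3) ℂ) =
        Matrix.diagonal (fun i => (z i : ℂ)) := by
  obtain ⟨T, -, hT, hTz⟩ := exists_signFrame_formCongr_eq L α w L₀ α₀ w₀ hreal hreal₀ hsame
  have hTz' : ∀ z : Fin 3 → Circle, T * circleDiagonal 3 z * T⁻¹ = circleDiagonal 3 z := by
    intro z
    have h := hTz z
    rw [mul_assoc, inv_mul_eq_iff_eq_mul] at h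
    rw [mul_inv_eq_iff_eq_mul]
    exact h.symm
  refine ⟨T, unitaryGroupOfFormCongrOfEq (starRingEnd ℂ) T ((Matrix.diagonal α).map w.1.embedding) ((Matrix.diagonal α₀).map w₀.1.embedding) hT,
    fun u => rfl, fun z => ?_, fun z => ?_⟩
  · apply Subtype.ext
    show T * circleDiagonal 3 z * T⁻¹ = circleDiagonal 3 z
    exact hTz' z
  · have h := congrArg (fun g : GL (Fin 3) ℂ => (g : Matrix (Fin 3) (Fin 3) ℂ)) (hTz' z)
    simpa only [Units.val_mul, coe_circleDiagonal] using h

end SignFrame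

section Transport

variable (L : Type) [Field L] (α : Fin 3 → L) (w : {w : InfinitePlace L // IsComplex w})
variable (L₀ : Type) [Field L₀] (α₀ : Fin 3 → L₀) (w₀ : {w : InfinitePlace L₀ // IsComplex w})
variable {E : Type*} [NormedAddCommGroup E] [NormedSpace ℝ E]

/-- **TRANSPORT OF TORUS ORBITAL INTEGRALS BETWEEN FRAMES, AT THE SAME TORUS POINT.**  For `e : G₀ ≃ₜ* G` with `e u = T u T⁻¹` and `e (t₀ z) = t z`, any measure `ν` on `G`, any `Θ`, any `z`:
`∫_G Θ(↑↑(g·t(z)·g⁻¹)) dν = ∫_{G₀} Θ(↑T · ↑↑(u·t₀(z)·u⁻¹) · ↑T⁻¹) d(ν.map e.symm)`. [cite: PlatonovRapinchuk1994, §2.3] [cite: Rogawski1990, §8.4 p. 126] -/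
theorem integral_comp_conj_eq_integral_map_symm_of_signs
    [MeasurableSpace (archLocal L 3 (Matrix.diagonal α) w)] [BorelSpace (archLocal L 3 (Matrix.diagonal α) w)]
    [MeasurableSpace (archLocal L₀ 3 (Matrix.diagonal α₀) w₀)] [BorelSpace (archLocal L₀ 3 (Matrix.diagonal α₀) w₀)]
    (T : GL (Fin 3) ℂ) (e : archLocal L₀ 3 (Matrix.diagonal α₀) w₀ ≃ₜ* archLocal L 3 (Matrix.diagonal α) w)
    (he : ∀ u : archLocal L₀ 3 (Matrix.diagonal α₀) w₀, ((e u : archLocal L 3 (Matrix.diagonal α) w) : GL (Fin 3) ℂ) = T * (u : GL (Fin 3) ℂ) * T⁻¹)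
    (hez : ∀ z : Fin 3 → Circle, e ⟨circleDiagonal 3 z, circleDiagonal_mem_archLocal_diagonal L₀ 3 α₀ w₀ z⟩ = ⟨circleDiagonal 3 z, circleDiagonal_mem_archLocal_diagonal L 3 α w z⟩)
    (ν : Measure (archLocal L 3 (Matrix.diagonal α) w)) (Θ : Matrix (Fin 3) (Fin 3) ℂ → E) (z : Fin 3 → Circle) :
    ∫ g, Θ (((g * ⟨circleDiagonal 3 z, circleDiagonal_mem_archLocal_diagonal L 3 α w z⟩ * g⁻¹ : archLocal L 3 (Matrix.diagonal α) w) : GL (Fin 3) ℂ) : Matrix (Fin 3) (Fin 3) ℂ) ∂ν =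
      ∫ u, Θ ((T : Matrix (Fin 3) (Fin 3) ℂ) *
          (((u * ⟨circleDiagonal 3 z, circleDiagonal_mem_archLocal_diagonal L₀ 3 α₀ w₀ z⟩ * u⁻¹ : archLocal L₀ 3 (Matrix.diagonal α₀) w₀) : GL (Fin 3) ℂ) : Matrix (Fin 3) (Fin 3) ℂ) *
          ((T⁻¹ : GL (Fin 3) ℂ) : Matrix (Fin 3) (Fin 3) ℂ)) ∂(ν.map e.symm) := by
  have hcoe : (e.symm.toHomeomorph.toMeasurableEquiv : archLocal L 3 (Matrix.diagonal α) w → archLocal L₀ 3 (Matrix.diagonal α₀) w₀) = e.symm := rfl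
  rw [← hcoe, integral_map_equiv]
  refine integral_congr_ae (Filter.Eventually.of_forall fun g => ?_)
  simp only [hcoe]
  congr 1
  -- `T · ↑(e⁻¹g · t₀ · (e⁻¹g)⁻¹) · T⁻¹ = ↑(e (e⁻¹g · t₀ · (e⁻¹g)⁻¹)) = ↑(g · t · g⁻¹)`
  have h1 : ((e (e.symm g * ⟨circleDiagonal 3 z, circleDiagonal_mem_archLocal_diagonal L₀ 3 α₀ w₀ z⟩ * (e.symm g)⁻¹) : archLocal L 3 (Matrix.diagonal α) w) : GL (Fin 3) ℂ) =
      T * (((e.symm g * ⟨circleDiagonal 3 z, circleDiagonal_mem_archLocal_diagonal L₀ 3 α₀ w₀ z⟩ * (e.symm g)⁻¹ : archLocal L₀ 3 (Matrix.diagonal α₀) w₀)) : GL (Fin 3) ℂ) * T⁻¹ :=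
    he _
  have h2 : e (e.symm g * ⟨circleDiagonal 3 z, circleDiagonal_mem_archLocal_diagonal L₀ 3 α₀ w₀ z⟩ * (e.symm g)⁻¹) =
      g * ⟨circleDiagonal 3 z, circleDiagonal_mem_archLocal_diagonal L 3 α w z⟩ * g⁻¹ := by
    rw [map_mul, map_mul, map_inv, ContinuousMulEquiv.apply_symm_apply, hez]
  rw [← Units.val_mul, ← Units.val_mul, ← h1, h2]

/-- The transported measure `ν.map e.symm` is a Haar measure (Mathlib `ContinuousMulEquiv.isHaarMeasure_map`). [cite: PlatonovRapinchuk1994, §2.3] -/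
theorem isHaarMeasure_map_symm_of_signs
    [MeasurableSpace (archLocal L 3 (Matrix.diagonal α) w)] [BorelSpace (archLocal L 3 (Matrix.diagonal α) w)]
    [MeasurableSpace (archLocal L₀ 3 (Matrix.diagonal α₀) w₀)] [BorelSpace (archLocal L₀ 3 (Matrix.diagonal α₀) w₀)]
    (e : archLocal L₀ 3 (Matrix.diagonal α₀) w₀ ≃ₜ* archLocal L 3 (Matrix.diagonal α) w)
    (ν : Measure (archLocal L 3 (Matrix.diagonal α) w)) [ν.IsHaarMeasure] : (ν.map e.symm).IsHaarMeasure :=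
  e.symm.isHaarMeasure_map ν

/-- … and right-invariant when `ν` is. [cite: PlatonovRapinchuk1994, §2.3] -/
theorem isMulRightInvariant_map_symm_of_signs
    [MeasurableSpace (archLocal L 3 (Matrix.diagonal α) w)] [BorelSpace (archLocal L 3 (Matrix.diagonal α) w)]
    [MeasurableSpace (archLocal L₀ 3 (Matrix.diagonal α₀) w₀)] [BorelSpace (archLocal L₀ 3 (Matrix.diagonal α₀) w₀)]
    (e : archLocal L₀ 3 (Matrix.diagonal α₀) w₀ ≃ₜ* archLocal L 3 (Matrix.diagonal α) w)
    (ν : Measure (archLocal L 3 (Matrix.diagonal α) w)) [ν.IsMulRightInvariant] : (ν.map e.symm).IsMulRightInvariant := by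
  refine ⟨fun h => ?_⟩
  have hm : Measurable (e.symm : archLocal L 3 (Matrix.diagonal α) w → archLocal L₀ 3 (Matrix.diagonal α₀) w₀) := e.symm.continuous.measurable
  obtain ⟨g, rfl⟩ := e.symm.surjective h
  rw [Measure.map_map (measurable_mul_const _) hm]
  conv_rhs => rw [← map_mul_right_eq_self ν g]
  rw [Measure.map_map hm (measurable_mul_const _)]
  congr 1
  funext x
  simp only [Function.comp_apply, map_mul]

end Transport

section TestFunction

open scoped Matrix.Norms.Operator

variable (L : Type) [Field L] (α : Fin 3 → L) (w : {w : InfinitePlace L // IsComplex w})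
variable (L₀ : Type) [Field L₀] (α₀ : Fin 3 → L₀) (w₀ : {w : InfinitePlace L₀ // IsComplex w})
variable {E : Type*} [NormedAddCommGroup E] [NormedSpace ℝ E]

omit [NormedSpace ℝ E] in
/-- **Compact support is transported to the source frame**: `u ↦ Θ(↑T·↑↑u·↑T⁻¹) = Θ(↑↑(e u))` is `(k ↦ Θ ↑↑k) ∘ e`. [cite: PlatonovRapinchuk1994, §2.3] [cite: Rogawski1990, §8.4 p. 126] -/
theorem hasCompactSupport_comp_conj_of_signs (T : GL (Fin 3) ℂ) (e : archLocal L₀ 3 (Matrix.diagonal α₀) w₀ ≃ₜ* archLocal L 3 (Matrix.diagonal α) w)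
    (he : ∀ u : archLocal L₀ 3 (Matrix.diagonal α₀) w₀, ((e u : archLocal L 3 (Matrix.diagonal α) w) : GL (Fin 3) ℂ) = T * (u : GL (Fin 3) ℂ) * T⁻¹)
    {Θ : Matrix (Fin 3) (Fin 3) ℂ → E} (hsupp : HasCompactSupport fun k : archLocal L 3 (Matrix.diagonal α) w => Θ ((k : GL (Fin 3) ℂ) : Matrix (Fin 3) (Fin 3) ℂ)) :
    HasCompactSupport fun u : archLocal L₀ 3 (Matrix.diagonal α₀) w₀ =>
      Θ ((T : Matrix (Fin 3) (Fin 3) ℂ) * ((u : GL (Fin 3) ℂ) : Matrix (Fin 3) (Fin 3) ℂ) * ((T⁻¹ : GL (Fin 3) ℂ) : Matrix (Fin 3) (Fin 3) ℂ)) := by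
  have h := hsupp.comp_homeomorph e.toHomeomorph
  have hfun : ((fun k : archLocal L 3 (Matrix.diagonal α) w => Θ ((k : GL (Fin 3) ℂ) : Matrix (Fin 3) (Fin 3) ℂ)) ∘ e.toHomeomorph) =
      fun u : archLocal L₀ 3 (Matrix.diagonal α₀) w₀ => Θ ((T : Matrix (Fin 3) (Fin 3) ℂ) * ((u : GL (Fin 3) ℂ) : Matrix (Fin 3) (Fin 3) ℂ) * ((T⁻¹ : GL (Fin 3) ℂ) : Matrix (Fin 3) (Fin 3) ℂ)) := by
    funext u
    simp only [Function.comp_apply]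
    show Θ (((e u : archLocal L 3 (Matrix.diagonal α) w) : GL (Fin 3) ℂ) : Matrix (Fin 3) (Fin 3) ℂ) = _
    rw [he u, Units.val_mul, Units.val_mul]
  rwa [hfun] at h

omit [NormedAddCommGroup E] [NormedSpace ℝ E] in
/-- On the torus `Θ ∘ Ad T` agrees with `Θ`: `Θ(↑T · diag z · ↑T⁻¹) = Θ(diag z)` (the frame commutes with the torus); in particular at the centre `ζ•1`. [cite: Rogawski1990, §8.4 p. 126] -/
theorem comp_conj_circleDiagonal_of_signs (T : GL (Fin 3) ℂ)
    (hTz : ∀ z : Fin 3 → Circle, (T : Matrix (Fin 3) (Fin 3) ℂ) * Matrix.diagonal (fun i => (z i : ℂ)) * ((T⁻¹ : GL (Fin 3) ℂ) : Matrix (Fin 3) (Fin 3) ℂ) = Matrix.diagonal (fun i => (z i : ℂ)))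
    (Θ : Matrix (Fin 3) (Fin 3) ℂ → E) (z : Fin 3 → Circle) :
    Θ ((T : Matrix (Fin 3) (Fin 3) ℂ) * ((circleDiagonal 3 z : GL (Fin 3) ℂ) : Matrix (Fin 3) (Fin 3) ℂ) * ((T⁻¹ : GL (Fin 3) ℂ) : Matrix (Fin 3) (Fin 3) ℂ)) =
      Θ ((circleDiagonal 3 z : GL (Fin 3) ℂ) : Matrix (Fin 3) (Fin 3) ℂ) := by
  rw [coe_circleDiagonal, hTz z]

end TestFunction

end Literature.NumberTheory.Automorphic.UnitaryGroup

end
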